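import Mathlib
import HarnessLib
import HarnessLib.Audit
import Summits.MatrixMultiplication.Statement
import Literature.Computability.AlgebraicComplexity.FlatteningBound

/-!
Route: CharacteristicContinuity

DORMANT since 2026-09-04T17:59:46Z (reconciler: no traction for 5 d (last activity item-evidence-added at 2026-08-30T17:04:06Z); parked, not closed — `ledger route dormant route-MatrixMultiplication-CharacteristicContinuity --off` to re) — unstaffed, not closed; items shared with open routes are served there. `ledger route dormant <id> --off` reactivates.

# Route CharacteristicContinuity — omega = 2 iff omega(F_p-bar) tends to 2 and omega is continuous
at characteristic zero

Lens 3.10 (weakest-unknown-consequence), POSITIVE use (P). Write ω_p := ω(F̄_p) = omega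
(AlgebraicClosure (ZMod p)) and ω_0 := ω(ℂ).
By the LEFSCHETZ PRINCIPLE applied to the Brent sentence "⟨n,n,n⟩ is a sum of r triads" (a
first-order sentence in the language of rings),
a rank bound R_ℂ(⟨n,n,n⟩) ≤ r holds over F̄_p for all but finitely many p, hence limsup_p ω_p ≤ ω_0
UNCONDITIONALLY (support
LefschetzUpperBound, PROVED in the planner folder, bc/CharTransfer.lean, 0 sorries) and ω_0 = 2 ⇒ W
(support Converse, PROVED: this is
the lens's `W_of_S`). It suffices to show X = W ∧ K: (W = LargeCharacteristicFast, the weakest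
unknown consequence of ω = 2 found)
ω_p → 2, i.e. for every ε > 0, ω_p ≤ 2 + ε for all large primes p; (K = ContinuityAtZero, the
complement) ω is lower semicontinuous at
characteristic zero along the primes, ω_0 ≤ liminf_p ω_p, i.e. for every ε > 0, ω_0 ≤ ω_p + ε for
all large p. Then ω_0 ≤ 2 + 2ε for
every ε and ω_0 ≥ 2 (flattening), so ω(ℂ) = 2; conversely ω(ℂ) = 2 gives W (Lefschetz) and K (ω_0 =
2 ≤ ω_p), so X ⟺ MatrixMultiplication
is CERTIFIED, and neither conjunct alone is known to imply it. No idea card is realised (lens-born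
line).
Lean: `(∀ ε : ℝ, 0 < ε → ∃ p₀ : ℕ, ∀ (p : ℕ) [Fact p.Prime], p₀ ≤ p →
Literature.Computability.AlgebraicComplexity.omega (AlgebraicClosure (ZMod p)) ≤ 2 + ε) ∧ (∀ ε : ℝ,
0 < ε → ∃ p₀ : ℕ, ∀ (p : ℕ) [Fact p.Prime], p₀ ≤ p →
Literature.Computability.AlgebraicComplexity.omega ℂ ≤
Literature.Computability.AlgebraicComplexity.omega (AlgebraicClosure (ZMod p)) + ε)`

## Assembly
Three lines of real arithmetic (PROVED in Sketch.lean and rendered as the deciding theorem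
`closes`): given δ > 0 take p₁ from W at δ/2, p₂ from K at δ/2 and a prime p ≥ max(p₁, p₂)
(`Nat.exists_infinite_primes`); then ω(ℂ) ≤ ω(F̄_p) + δ/2 ≤ 2 + δ; so ω(ℂ) ≤ 2
(`le_of_forall_pos_le_add`) and 2 ≤ ω(ℂ) is `omega_two_le ℂ` (FlatteningBound, proved).

Rationale: WHY THIS LINE. The mechanism is model-theoretic transfer: ω(k) depends only on the characteristic
(BurgisserClausenShokrollahi1997 Cor. 15.18 covers field EXTENSIONS only; the dependence on the
characteristic is open in both directions, Blaser2013 §5, Pan1984 §5), and Mathlib's Lefschetz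
principle (`FirstOrder.Field.ACF_zero_realize_iff_finite_ACF_prime_not_realize`) turns each finite
rank bound into a statement valid in cofinitely many characteristics, which makes ω = 2 EQUIVALENT
to "fast in large characteristic + continuous at characteristic 0" with the equivalence
machine-checked. What is imported: first-order model theory of algebraically closed fields (Ax,
Lefschetz) for the split and for the proved half (upper semicontinuity); modular representation
theory of finite groups of Lie type for W's line (in DEFINING characteristic the Steinberg module of
GL_n(𝔽_p) is simple and projective, a block of defect zero, so M_{p^{n(n-1)/2}}(F̄_p) is a direct
factor of the NON-semisimple algebra F̄_p[GL_n(𝔽_p)] with dimension exponent → 1/2: Craven2019 §9.1,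
Humphreys2005 Ch. 9), i.e. a characteristic-p carrier of matrix multiplication that needs no
transfer at all; and for K the regularity reading "near-optimal characteristic-p algorithms occur at
sizes bounded uniformly in p" (support UniformWitnessIff, proved both ways), whose negation is a
sequence of characteristic-SPORADIC fast algorithms of growing size — the asymptotic form of the
finite phenomenon 47 = R_{𝔽₂}-record < 48 = R_ℚ-record for ⟨4,4,4⟩ (FawziEtAl2022; lifting
obstructions KauersMoosbauer2022FlipGraphs §5). Prior routes: ModularHeisenberg transfers the
asymptotic rank of ONE tensor T_p per prime with an unproved lift (CharacteristicLift) and needs it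
because p-groups have no non-trivial simple modules in characteristic p; HenselReesLifting lists N1
= "∀ p, ω(ℂ) ≤ ω(F̄_p)" as not decomposed; IntegralSignedBoxes (PrimeHasse) explicitly factors
characteristic dependence OUT. This line makes the characteristic dependence of ω itself the crux,
in its weakest (limit, ε) form, supplies the proved transfer theorems every characteristic-p route
needs, and its W-line carries the matrix block natively in characteristic p (Steinberg block), so
the only transfer left is K. Negatives index (7 entries): none concerns characteristic or ω over
finite fields.

RANKED CRUXES. #2 ContinuityAtZero (crux) — K — lower semicontinuity of ω at characteristic zero
along the primes: for every ε > 0 there is p₀ with ω(ℂ) ≤ ω(F̄_p) + ε for all primes p ≥ p₀ (with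
the proved upper bound this is lim_p ω(F̄_p) = ω(ℂ); equivalently uniform witness sizes across large
characteristics; equivalently no characteristic-sporadic fast families). [difficulty: open-problem]
(why it might fail: sporadic algorithms exist at finite level (⟨4,4,4⟩: 47 over 𝔽₂ vs 48 over ℚ,
>10⁵ rank-47 𝔽₂-schemes all obstructed mod 4); a family of growing size along p → ∞ would make
liminf_p ω(F̄_p) < ω(ℂ), and no lifting or uniformity tool exists.)
[BurgisserClausenShokrollahi1997, Blaser2013, Pan1984, FawziEtAl2022, KauersMoosbauer2022FlipGraphs,
Schonhage1981]
#3 LargeCharacteristicFast (crux) — W — the weakest unknown consequence of ω(ℂ) = 2 found by the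
lens (W_of_S PROVED via Lefschetz): matrix multiplication is asymptotically fast in large
characteristic, lim sup_p ω(F̄_p) = 2: for every ε > 0, ω(F̄_p) ≤ 2 + ε for all sufficiently large
primes p. Line (birth skeleton): Steinberg block of F̄_p[GL_n(𝔽_p)] + a characteristic-p Cohn–Umans
bound for that one family. [difficulty: open-problem] (why it might fail: every known fast algorithm
is characteristic-free, so W may be exactly as hard as ω = 2; all catalogued upper-bound barriers
hold verbatim over F̄_p; the non-defect-zero blocks of F̄_p[GL_n(𝔽_p)] may have rank far above their
dimension.) [Blaser2013, CohnUmans2003, Craven2019, Humphreys2005, BurgisserClausenShokrollahi1997]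
#9 LefschetzUpperBound (support) — the KNOWN half, upper semicontinuity at characteristic zero: for
every ε > 0, ω(F̄_p) ≤ ω(ℂ) + ε for all large primes p (Lefschetz on the Brent sentence of one
near-optimal complex scheme; PROVED sorry-free in the planner folder bc/CharTransfer.lean as
`lefschetzUpperBound`, with `brentSentence`, `realize_brentSentence`,
`tensorRank_transfer_up/down`). [difficulty: provable-now] [BurgisserClausenShokrollahi1997,
Blaser2013]
#9 Converse (support) — losslessness (the lens's W_of_S and K_of_S): ω(ℂ) = 2 implies both cruxes —
W by LefschetzUpperBound, K because 2 ≤ ω(F̄_p) (flattening over any field). PROVED in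
bc/CharTransfer.lean (`W_of_S`, `K_of_S`). With `closes` this certifies X ⟺ MatrixMultiplication.
[difficulty: provable-now] [BurgisserClausenShokrollahi1997, Blaser2013]
#9 UniformWitnessIff (support) — the regularity form of K: ContinuityAtZero ↔ uniform witness sizes
(for every ε > 0 there are N, p₀ such that every prime p ≥ p₀ has some 2 ≤ n ≤ N with
R_{F̄_p}(⟨n,n,n⟩) ≤ n^{ω(F̄_p)+ε}); → by transferring the complex witness up, ← by pigeonhole over
the finitely many (n, r) and downward Lefschetz. PROVED both ways in bc/CharTransfer.lean.
[difficulty: provable-now] [BurgisserClausenShokrollahi1997, Blaser2013]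
#9 FixedFormatContinuity (support) — the special case of K at every FIXED format (BC5): for all k,
m, n the rank of ⟨k,m,n⟩ is eventually characteristic-independent, R_{F̄_p}(⟨k,m,n⟩) = R_ℂ(⟨k,m,n⟩)
for all large primes p (both Lefschetz directions over the finitely many r ≤ kmn). PROVED in
bc/CharTransfer.lean (`tensorRank_eventually_eq`). K is exactly the statement that the threshold
p₀(n) does not outrun the sizes at which ω(F̄_p) is approached. [difficulty: provable-now]
[BurgisserClausenShokrollahi1997, KauersMoosbauer2022FlipGraphs]
#9 SporadicRankDrop (support) — kill-side finite shadow of ¬K, staffable by refuters and compute: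
some matrix multiplication tensor is STRICTLY cheaper in some positive characteristic than over ℂ,
R_{F̄_p}(⟨k,m,n⟩) < R_ℂ(⟨k,m,n⟩) for some p, k, m, n. Unknown: the first candidates are ⟨4,4,4⟩ (47
over 𝔽₂ vs 48 over ℚ, neither optimality proved) and the small formats where R_ℂ is known exactly
(⟨2,2,2⟩ = 7, ⟨2,2,3⟩ = 11, ⟨2,2,n⟩ = ⌈7n/2⌉); a certified instance is the first characteristic
dependence of a matrix multiplication rank and grounds ¬K's mechanism, a proof of its negation at
all formats is the finite form of "characteristic 0 is never harder". [difficulty: L]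
[FawziEtAl2022, KauersMoosbauer2022FlipGraphs, HopcroftKerr1971]

TWO-LAYER PLAN. Foreseen glued splits (registered as birth skeletons, bc/*_birth.lean, sorries only
in stubs, compositions PROVED): LargeCharacteristicFast ⇐ SteinbergBlock (∀ n ≥ 2 ∀ p:
R_{F̄_p}(⟨p^N,p^N,p^N⟩) ≤ R(F̄_p[GL_n(𝔽_p)]), N = n(n−1)/2; defect-zero block, Craven2019 §9.1) →
ModularGroupAlgebraRank (∀ n ≥ 2 ∃ C_n ∀ p: R(F̄_p[GL_n(𝔽_p)]) ≤ C_n p^{n²+n} = C_n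
|GL_n(𝔽_p)|^{1+1/n+o(1)}; the open characteristic-p Cohn–Umans bound) → LargeCharacteristicFast
(ω(F̄_p) ≤ 2(n+1)/(n−1) + o_p(1), n → ∞). ContinuityAtZero ⇐ UniformWitness (open) → TransferDown
(proved) → ContinuityAtZero (pigeonhole). Nothing filed now.

KILL CRITERIA. ¬ContinuityAtZero (∃ δ > 0 and infinitely many p with ω(F̄_p) ≤ ω(ℂ) − δ:
characteristic-sporadic fast families) closes the route `refuted:ContinuityAtZero` — and is itself a
landmark (first proof that ω depends on the characteristic; it needs a lower bound on ω(ℂ), so it is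
not cheap). ¬LargeCharacteristicFast (ω(F̄_p) ≥ 2 + δ for infinitely many p) refutes the summit
outright via Converse (W is NECESSARY) and every positive route with it. A LOOKUP kills the novelty:
if "lim_p ω(F̄_p) = ω(ℂ)" or "ω(F̄_p) ≥ ω(ℚ) for all large p" is already a theorem, K is known and
the route contracts to W (then a LADDER rung, not a route). A proof of K elsewhere (e.g.
HenselReesLifting's N1 for all large p) contracts the route to W. AThesis of AsymptoticSpectrum /
any proof of ω(ℂ) = 2 moots it; any certified instance of SporadicRankDrop is evidence for ¬K's
mechanism (not a refutation).

NOT DECOMPOSED YET. The effective Lefschetz threshold for Brent systems (how large p must be, as a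
function of n, for R_{F̄_p}(⟨n,n,n⟩) = R_ℂ(⟨n,n,n⟩); arithmetic Bézout / Krick–Pardo heights, cf.
the tree's BurgisserReductionModPrimes under GRH) and the matching rate statement in characteristic
p (children of ContinuityAtZero); the Steinberg-block restriction lemma and the structure
(Jennings/radical filtration) of the non-defect-zero part of F̄_p[GL_n(𝔽_p)] (children of
LargeCharacteristicFast); the finite census of SporadicRankDrop candidates; ω over F̄_p versus 𝔽_p
(extension invariance in characteristic p, Schönhage — not needed by `closes`). All layer-2, after a
crux moves.

CHEAPEST FALSIFIER. A LOOKUP, run: is the characteristic (in)dependence of ω, or its limit form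
lim_p ω(F̄_p) = ω(ℂ), a theorem? BurgisserClausenShokrollahi1997 p. 410 ("ω(k) can depend only (if
at all) on the characteristic of k") and Cor. 15.18 (extensions only), the tree's own docstring of
MatrixMultiplicationAllFields ("whether it does ... is open"), the closed card
arithmetic-of-omega-essential-primes ("the folklore-open inequality ω(F_p) ≤ ω(ℂ)") and
HenselReesLifting's undecomposed N1 all record it as OPEN; `lean search 'omega (AlgebraicClosure
(ZMod'` finds no theorem. Second cheapest: the finite census — compare exact/record ranks of
⟨2,2,3⟩, ⟨2,3,3⟩, ⟨3,3,3⟩, ⟨4,4,4⟩ over 𝔽₂, 𝔽₃ and ℚ in the published catalogues (arXiv:2212.01175,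
arXiv:2603.02398 §7.4): a certified SporadicRankDrop instance would show the sporadic mechanism is
real at finite level.

NUMBERS. ω(ℂ) ≤ 2.371552 (VXXZ2024, tree: vxxz2024_omegaRect_table.omega_le); 2 ≤ ω(K) ≤ 3 for every
field (tree: omega_mem_Icc_two_three). ⟨4,4,4⟩: rank ≤ 47 over 𝔽₂ (FawziEtAl2022), ≤ 48 over ℚ/ℂ, 49
over ℤ; none of > 10⁵ rank-47 𝔽₂-schemes lifts to ℤ/4 (KauersMoosbauer2022FlipGraphs §5). R(⟨2,2,2⟩)
= 7 over every field; R(⟨2,2,n⟩) = ⌈7n/2⌉ (HopcroftKerr1971, over 𝔽₂ and in general). dim St =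
p^{n(n−1)/2}, |GL_n(𝔽_p)| = p^{n(n−1)/2} ∏_{i=1}^{n} (p^i − 1) < p^{n²}; the W-skeleton gives
ω(F̄_p) ≤ 2(n+1)/(n−1) + log C_n / (N log p). Items at open: 8 (2 cruxes, 5 supports, 1 assembly).

DEFINITION REQUESTS. None: omega, tensorRank, matMulTensor (MatrixMultiplicationExponent),
groupTensor (GroupAlgebraTensor), AlgebraicClosure, ZMod, GL, FirstOrder.Language.ring (Mathlib) all
exist; the Brent sentence `brentSentence` is defined and its realisation lemma proved in the planner
folder (to be landed with LefschetzUpperBound).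

Novelty: Searches (2026-08-17): `lit search --hybrid "exponent of matrix multiplication depends only on the
characteristic of the field"` (8; BCS1997 p. 410 the only relevant hit); `lit search --hybrid
"whether the exponent of matrix multiplication depends on the characteristic ... is not known"` (8;
BCS, Landsberg2017); `lit galaxy search "exponent of matrix multiplication characteristic of the
field independent" --star all` (0) and two shorter variants (0, 0); `lit search --hybrid "Steinberg
module ... projective block of defect zero"` (8; Craven2019 pp. 233, 238 read); `lean search 'omega
(AlgebraicClosure (ZMod'` (1 docstring hit: HenselReesLifting N1, not filed), `lean search
'ACF_zero_realize_iff|Theory.ACF'` (no use in AlgebraicComplexity; Lefschetz used only in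
AlgebraicGeometry/EffectiveResolution); all 69 Theses headers of the sub and the 46 open + 128
closed idea cards grepped for Lefschetz/ultraproduct/characteristic (hits:
arithmetic-of-omega-essential-primes [closed, variant, superseded by IntegralSignedBoxes],
brent-scheme-specialisation [closed], modular-heisenberg-transfer [routed],
hensel-rees-obstruction-calculus [routed]); corpus conditional_facts_lit.json (31 rows, noise except
BCS ch. 15–16).
Nearest prior art found: route-MatrixMultiplication-ModularHeisenberg (CharacteristicLift: per-prime
transfer of the asymptotic rank of the Heisenberg table T_p, unproved, + modular minimality) and
card hensel-rees-obstruction-calculus N1 (∀ p, ω(ℚ̄) ≤ ω(F̄_p), listed NOT de  [refs: Landsberg2017, Craven2019, BurgisserClausenShokrollahi1997, Pan1984]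

Barriers (technique_class: characteristic-transfer, model-theory, modular-group-algebra): - technique_class: characteristic-transfer, model-theory, modular-group-algebra
- Literature.Barriers.MatrixMultiplication.InfimumNotMinimumBarrier: respected — both cruxes are
limit statements in p and ε; the transfer lemmas move single finite rank bounds, never an attained
exponent.
- Literature.Barriers.MatrixMultiplication.IrreversibilityBarrier: it does not evade it; CVZ2021 is
a statement about the asymptotic spectrum over an arbitrary field, so any fixed-intermediate-tensor
proof of W in F̄_p is barred exactly as over ℂ; the W-skeleton uses no fixed intermediate tensor (a
family of modular group algebras of growing Lie rank n and growing p).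
- Literature.Barriers.MatrixMultiplication.UniversalMethodBarrier: same — field-independent, applies
verbatim to W for CW_q-type carriers in characteristic p; not in the class of the Steinberg-block
line (no Coppersmith–Winograd tensor).
- Literature.Barriers.MatrixMultiplication.RectangularBarrier: n/a (no rectangular exponent, no
fixed intermediate tensor).
- Literature.Barriers.MatrixMultiplication.NilpotentGroupBarrier: its slice-rank bound for MODULAR
group algebras of p-groups is exactly why p-groups are useless here (F̄_p[P] is local, no matrix
block); the line uses GL_n(𝔽_p), not nilpotent, whose modular group algebra HAS a full matrix block
(defect zero) — the barrier's hypothesis (bounded exponent/class nilpotent hosts, STPP via CKSU) is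
not met; conceded: the non-defect-zero blocks are unstable/irreversible in the barrie

History (route lifecycle, newest last):
- 2026-08-23T18:56:05Z · DORMANT — reconciler: no traction for 6.2 d (last activity item-evidence-added at 2026-08-17T14:20:21Z); parked, not closed — `ledger route dormant route-MatrixMultiplica (operator:999:342192)
- 2026-08-30T07:11:09Z · REACTIVATED — reconciler: reactivated — activity item-evidence-added at 2026-08-30T06:13:08Z after parking at 2026-08-23T18:56:05Z (operator:999:383234)
- 2026-09-04T17:59:46Z · DORMANT — reconciler: no traction for 5 d (last activity item-evidence-added at 2026-08-30T17:04:06Z); parked, not closed — `ledger route dormant route-MatrixMultiplicati (operator:999:1782432)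

sub-problem: MatrixMultiplication · status: dormant · opened planner-plan-lens3-MatrixMultiplication-wuc-0 2026-08-17T02:18:45Z · rev 4 · ledger route-MatrixMultiplication-CharacteristicContinuity
GENERATED by the gate from the ledger (D-0016/17). Provers cite these decls: `theorem foo : Summit.MatrixMultiplication.MatrixMultiplication.Theses.CharacteristicContinuity.<Decl> := …` in Summits/MatrixMultiplication/MatrixMultiplication/Theorems/<Name>.lean.
-/

namespace Summit.MatrixMultiplication.MatrixMultiplication.Theses.CharacteristicContinuity

open scoped BigOperators Topology Manifold Classical MeasureTheory ProbabilityTheory Matrix InnerProductSpace ComplexConjugate ContinuousMap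
open Filter Set Function TopologicalSpace MeasureTheory

attribute [summit_statement] _root_.MatrixMultiplication

/-- item stmt-MatrixMultiplication-18039 · crux · rank 2 · open · by planner
why it might fail: sporadic algorithms exist at finite level (⟨4,4,4⟩: 47 over 𝔽₂ vs 48 over ℚ, >10⁵ rank-47 𝔽₂-schemes all obstructed mod 4); a family of growing size along p → ∞ would make liminf_p ω(F̄_p) < ω(ℂ), and no lifting or uniformity tool exists.
sources: BurgisserClausenShokrollahi1997, Blaser2013, Pan1984, FawziEtAl2022, KauersMoosbauer2022FlipGraphs, Schonhage1981
[crux] K — lower semicontinuity of ω at characteristic zero along the primes: for every ε > 0 there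
is p₀ with ω(ℂ) ≤ ω(F̄_p) + ε for all primes p ≥ p₀ (with the proved upper bound this is lim_p
ω(F̄_p) = ω(ℂ); equivalently uniform witness sizes across large characteristics; equivalently no
characteristic-sporadic fast families). [difficulty: open-problem] -/
@[route_item "route-MatrixMultiplication-CharacteristicContinuity"]
def ContinuityAtZero : Prop :=
  ∀ ε : ℝ, 0 < ε → ∃ p₀ : ℕ, ∀ (p : ℕ) [Fact p.Prime], p₀ ≤ p → Literature.Computability.AlgebraicComplexity.omega ℂ ≤ Literature.Computability.AlgebraicComplexity.omega (AlgebraicClosure (ZMod p)) + ε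

/-- item stmt-MatrixMultiplication-30790 · crux · rank 2 · open · by planner
[crux] K′ = EVENTUAL TRANSFER (residual, strictly weaker than ContinuityAtZero = K): an exponent
bound ω(𝔽̄_p) ≤ β valid in ALL sufficiently large characteristics p transfers to characteristic
zero, ω(ℂ) ≤ β — i.e. ω(ℂ) ≤ limsup_p ω(𝔽̄_p) (K is the liminf form). Exact cut: ω(ℂ)=2 ↔
LargeCharacteristicFast ∧ EventualTransfer (kernel
`matrixMultiplication_iff_fast_and_eventualTransfer`, decomp-mm lens-5 g10); K → K′
(`eventualTransfer_of_continuityAtZero`); K′ ↛ K as a law (alternating exponent profile). Lens form: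
K′ ↔ near-optimal witnesses of bounded format occur for infinitely many p
(`eventualTransfer_iff_uniformWitnessIO`). Why it might fail: a first-order/Lefschetz transfer moves
each fixed-format rank statement but not the infinite conjunction defining ω; sporadic near-optimal
schemes in every large characteristic at formats → ∞ (cf. ⟨4,4,4⟩: 47 over 𝔽₂ vs 48 in char 0) would
violate it. Sources: BurgisserClausenShokrollahi1997 Cor. (15.18), §15.3; Blaser2013 Def. 5.1;
Schonhage1981 Thm 2.8. -/
@[route_item "route-MatrixMultiplication-CharacteristicContinuity"]
def EventualTransfer : Prop :=
  ∀ β : ℝ, (∃ p₀ : ℕ, ∀ (p : ℕ) [Fact p.Prime], p₀ ≤ p → Literature.Computability.AlgebraicComplexity.omega (AlgebraicClosure (ZMod p)) ≤ β) → Literature.Computability.AlgebraicComplexity.omega ℂ ≤ β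

/-- item stmt-MatrixMultiplication-18040 · crux · rank 3 · open · by planner
why it might fail: every known fast algorithm is characteristic-free, so W may be exactly as hard as ω = 2; all catalogued upper-bound barriers hold verbatim over F̄_p; the non-defect-zero blocks of F̄_p[GL_n(𝔽_p)] may have rank far above their dimension.
sources: Blaser2013, CohnUmans2003, Craven2019, Humphreys2005, BurgisserClausenShokrollahi1997
[crux] W — the weakest unknown consequence of ω(ℂ) = 2 found by the lens (W_of_S PROVED via
Lefschetz): matrix multiplication is asymptotically fast in large characteristic, lim sup_p ω(F̄_p)
= 2: for every ε > 0, ω(F̄_p) ≤ 2 + ε for all sufficiently large primes p. Line (birth skeleton):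
Steinberg block of F̄_p[GL_n(𝔽_p)] + a characteristic-p Cohn–Umans bound for that one family.
[difficulty: open-problem] -/
@[route_item "route-MatrixMultiplication-CharacteristicContinuity"]
def LargeCharacteristicFast : Prop :=
  ∀ ε : ℝ, 0 < ε → ∃ p₀ : ℕ, ∀ (p : ℕ) [Fact p.Prime], p₀ ≤ p → Literature.Computability.AlgebraicComplexity.omega (AlgebraicClosure (ZMod p)) ≤ 2 + ε

/-- item stmt-MatrixMultiplication-18041 · support · rank 9 · closed · proved by Summit.MatrixMultiplication.MatrixMultiplication.Theorems.CharacteristicContinuityTransfer.lefschetzUpperBound_holds (planner) · by planner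
sources: BurgisserClausenShokrollahi1997, Blaser2013
[support] the KNOWN half, upper semicontinuity at characteristic zero: for every ε > 0, ω(F̄_p) ≤
ω(ℂ) + ε for all large primes p (Lefschetz on the Brent sentence of one near-optimal complex scheme;
PROVED sorry-free in the planner folder bc/CharTransfer.lean as `lefschetzUpperBound`, with
`brentSentence`, `realize_brentSentence`, `tensorRank_transfer_up/down`). [difficulty: provable-now] -/
@[route_item "route-MatrixMultiplication-CharacteristicContinuity"]
def LefschetzUpperBound : Prop :=
  ∀ ε : ℝ, 0 < ε → ∃ p₀ : ℕ, ∀ (p : ℕ) [Fact p.Prime], p₀ ≤ p → Literature.Computability.AlgebraicComplexity.omega (AlgebraicClosure (ZMod p)) ≤ Literature.Computability.AlgebraicComplexity.omega ℂ + ε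

-- `LefschetzUpperBound` holds: proved by `Summit.MatrixMultiplication.MatrixMultiplication.Theorems.CharacteristicContinuityTransfer.lefschetzUpperBound_holds` (its module imports this route file, so no `_holds` link can be stated here).

/-- item stmt-MatrixMultiplication-18042 · support · rank 9 · closed · proved by Summit.MatrixMultiplication.MatrixMultiplication.Theorems.CharacteristicContinuityTransfer.converse_holds (planner) · by planner
sources: BurgisserClausenShokrollahi1997, Blaser2013
[support] losslessness (the lens's W_of_S and K_of_S): ω(ℂ) = 2 implies both cruxes — W by
LefschetzUpperBound, K because 2 ≤ ω(F̄_p) (flattening over any field). PROVED in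
bc/CharTransfer.lean (`W_of_S`, `K_of_S`). With `closes` this certifies X ⟺ MatrixMultiplication.
[difficulty: provable-now] -/
@[route_item "route-MatrixMultiplication-CharacteristicContinuity"]
def Converse : Prop :=
  MatrixMultiplication → (∀ ε : ℝ, 0 < ε → ∃ p₀ : ℕ, ∀ (p : ℕ) [Fact p.Prime], p₀ ≤ p → Literature.Computability.AlgebraicComplexity.omega (AlgebraicClosure (ZMod p)) ≤ 2 + ε) ∧ (∀ ε : ℝ, 0 < ε → ∃ p₀ : ℕ, ∀ (p : ℕ) [Fact p.Prime], p₀ ≤ p → Literature.Computability.AlgebraicComplexity.omega ℂ ≤ Literature.Computability.AlgebraicComplexity.omega (AlgebraicClosure (ZMod p)) + ε)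

-- `Converse` holds: proved by `Summit.MatrixMultiplication.MatrixMultiplication.Theorems.CharacteristicContinuityTransfer.converse_holds` (its module imports this route file, so no `_holds` link can be stated here).

/-- item stmt-MatrixMultiplication-18043 · support · rank 9 · closed · proved by Summit.MatrixMultiplication.MatrixMultiplication.Theorems.CharacteristicContinuityUniformWitness.uniformWitnessIff_holds (planner) · by planner
sources: BurgisserClausenShokrollahi1997, Blaser2013
[support] the regularity form of K: ContinuityAtZero ↔ uniform witness sizes (for every ε > 0 there
are N, p₀ such that every prime p ≥ p₀ has some 2 ≤ n ≤ N with R_{F̄_p}(⟨n,n,n⟩) ≤ n^{ω(F̄_p)+ε}); →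
by transferring the complex witness up, ← by pigeonhole over the finitely many (n, r) and downward
Lefschetz. PROVED both ways in bc/CharTransfer.lean. [difficulty: provable-now] -/
@[route_item "route-MatrixMultiplication-CharacteristicContinuity"]
def UniformWitnessIff : Prop :=
  (∀ ε : ℝ, 0 < ε → ∃ p₀ : ℕ, ∀ (p : ℕ) [Fact p.Prime], p₀ ≤ p → Literature.Computability.AlgebraicComplexity.omega ℂ ≤ Literature.Computability.AlgebraicComplexity.omega (AlgebraicClosure (ZMod p)) + ε) ↔ (∀ ε : ℝ, 0 < ε → ∃ N p₀ : ℕ, ∀ (p : ℕ) [Fact p.Prime], p₀ ≤ p → ∃ n : ℕ, 2 ≤ n ∧ n ≤ N ∧ (Literature.Computability.AlgebraicComplexity.tensorRank (Literature.Computability.AlgebraicComplexity.matMulTensor (AlgebraicClosure (ZMod p)) n n n) : ℝ) ≤ (n : ℝ) ^ (Literature.Computability.AlgebraicComplexity.omega (AlgebraicClosure (ZMod p)) + ε))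

-- `UniformWitnessIff` holds: proved by `Summit.MatrixMultiplication.MatrixMultiplication.Theorems.CharacteristicContinuityUniformWitness.uniformWitnessIff_holds` (its module imports this route file, so no `_holds` link can be stated here).

/-- item stmt-MatrixMultiplication-18044 · support · rank 9 · closed · proved by Summit.MatrixMultiplication.MatrixMultiplication.Theorems.CharacteristicContinuityFixedFormat.fixedFormatContinuity_holds (planner) · by planner
sources: BurgisserClausenShokrollahi1997, KauersMoosbauer2022FlipGraphs
[support] the special case of K at every FIXED format (BC5): for all k, m, n the rank of ⟨k,m,n⟩ is
eventually characteristic-independent, R_{F̄_p}(⟨k,m,n⟩) = R_ℂ(⟨k,m,n⟩) for all large primes p (both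
Lefschetz directions over the finitely many r ≤ kmn). PROVED in bc/CharTransfer.lean
(`tensorRank_eventually_eq`). K is exactly the statement that the threshold p₀(n) does not outrun
the sizes at which ω(F̄_p) is approached. [difficulty: provable-now] -/
@[route_item "route-MatrixMultiplication-CharacteristicContinuity"]
def FixedFormatContinuity : Prop :=
  ∀ k m n : ℕ, ∃ p₀ : ℕ, ∀ (p : ℕ) [Fact p.Prime], p₀ ≤ p → Literature.Computability.AlgebraicComplexity.tensorRank (Literature.Computability.AlgebraicComplexity.matMulTensor (AlgebraicClosure (ZMod p)) k m n) = Literature.Computability.AlgebraicComplexity.tensorRank (Literature.Computability.AlgebraicComplexity.matMulTensor ℂ k m n)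

-- `FixedFormatContinuity` holds: proved by `Summit.MatrixMultiplication.MatrixMultiplication.Theorems.CharacteristicContinuityFixedFormat.fixedFormatContinuity_holds` (its module imports this route file, so no `_holds` link can be stated here).

/-- item stmt-MatrixMultiplication-18045 · support · rank 9 · open · by planner
sources: FawziEtAl2022, KauersMoosbauer2022FlipGraphs, HopcroftKerr1971
[support] kill-side finite shadow of ¬K, staffable by refuters and compute: some matrix
multiplication tensor is STRICTLY cheaper in some positive characteristic than over ℂ,
R_{F̄_p}(⟨k,m,n⟩) < R_ℂ(⟨k,m,n⟩) for some p, k, m, n. Unknown: the first candidates are ⟨4,4,4⟩ (47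
over 𝔽₂ vs 48 over ℚ, neither optimality proved) and the small formats where R_ℂ is known exactly
(⟨2,2,2⟩ = 7, ⟨2,2,3⟩ = 11, ⟨2,2,n⟩ = ⌈7n/2⌉); a certified instance is the first characteristic
dependence of a matrix multiplication rank and grounds ¬K's mechanism, a proof of its negation at
all formats is the finite form of "characteristic 0 is never harder". [difficulty: L] -/
@[route_item "route-MatrixMultiplication-CharacteristicContinuity"]
def SporadicRankDrop : Prop :=
  ∃ (p : ℕ) (_ : Fact p.Prime) (k m n : ℕ), Literature.Computability.AlgebraicComplexity.tensorRank (Literature.Computability.AlgebraicComplexity.matMulTensor (AlgebraicClosure (ZMod p)) k m n) < Literature.Computability.AlgebraicComplexity.tensorRank (Literature.Computability.AlgebraicComplexity.matMulTensor ℂ k m n)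

/-- item stmt-MatrixMultiplication-31172 · support · rank 9 · open · by planner
[aside] A = ClusterAtTwo (lim inf_p ω(𝔽̄_p) = 2; M2′ of the decomp-mm cell, writer/critic-endorsed
as a banked aside): for every ε > 0 there are infinitely many primes p with ω(𝔽̄_p) ≤ 2 + ε. WEAKER
than LargeCharacteristicFast 18040 (W → A trivially) and NECESSARY for S (18041). Exact dual corner
S ↔ A ∧ ContinuityAtZero (kernel matrixMultiplication_iff_cluster_and_continuity in
Theorems/CharacteristicContinuityEventualTransfer.lean, p766313); A ∧ EventualTransfer does NOT give
S (schema_cluster_and_eventual_not_exact), so the two minimal exact corners are (W,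
EventualTransfer) and (A, ContinuityAtZero). Banked context, out of the cone of closes; not to be
staffed. Why it might fail: exactly as W — every known fast algorithm is characteristic-free, a
char-p-only speed-up mechanism (non-semisimple group-algebra blocks, Steinberg block of
𝔽̄_p[GL_n(𝔽_p)]) is unexplored. Sources: Blaser2013 Def. 5.1; BurgisserClausenShokrollahi1997 §15.3;
CohnUmans2003. -/
@[route_item "route-MatrixMultiplication-CharacteristicContinuity"]
def ClusterAtTwo : Prop :=
  ∀ ε : ℝ, 0 < ε → ∀ p₀ : ℕ, ∃ (p : ℕ) (_ : Fact p.Prime), p₀ ≤ p ∧ Literature.Computability.AlgebraicComplexity.omega (AlgebraicClosure (ZMod p)) ≤ 2 + ε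

/-- item stmt-MatrixMultiplication-18046 · assembly · rank 1 · closed · proved by Summit.MatrixMultiplication.MatrixMultiplication.Theorems.CharacteristicContinuityUniformWitness.assembly_holds (planner) · by planner
sources: Blaser2013, BurgisserClausenShokrollahi1997
[assembly] LargeCharacteristicFast → ContinuityAtZero → MatrixMultiplication. -/
@[route_item "route-MatrixMultiplication-CharacteristicContinuity"]
def Assembly : Prop :=
  LargeCharacteristicFast → ContinuityAtZero → MatrixMultiplication

-- `Assembly` holds: proved by `Summit.MatrixMultiplication.MatrixMultiplication.Theorems.CharacteristicContinuityUniformWitness.assembly_holds` (its module imports this route file, so no `_holds` link can be stated here).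

/-! D-0027 §2.1 — DECIDING THEOREM (planner-authored via `route open/edit --closes-file`; by operator:999:3401373 2026-08-30T10:20:55Z):
its hypotheses are this route's items and its conclusion the sub-problem Statement (glue_lint), and it elaborates with this file. -/

@[closes "route-MatrixMultiplication-CharacteristicContinuity"] theorem closes (hW : LargeCharacteristicFast) (hK' : EventualTransfer) : MatrixMultiplication := by
  show Literature.Computability.AlgebraicComplexity.omega ℂ = 2
  refine le_antisymm ?_ (Literature.Computability.AlgebraicComplexity.omega_two_le ℂ)
  exact le_of_forall_pos_le_add fun δ hδ => hK' (2 + δ) (hW δ hδ)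

end Summit.MatrixMultiplication.MatrixMultiplication.Theses.CharacteristicContinuity
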